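import Mathlib
import HarnessLib
import Literature.Probability.RandomPlanarGeometry.NestingTransform
import Literature.Probability.Percolation.NestingPhaseEstimates
import Literature.Probability.Percolation.NestingWeightMeasurable
import Literature.Probability.Percolation.SiteNestingWeightBound
import Summits.CriticalPhenomena.CardyFormulaZ2.Theorems.CardyMagicRigidityMagicFormulaTStubUVSandwich
import Summits.CriticalPhenomena.CardyFormulaZ2.Theorems.CardyMagicRigidityMagicFormulaTCountRepresentation

/-!
# Line `Sketch` for crux `MagicFormulaT`, sub-goal `cr3_expect_powerSums_eq_counts`:
# the count representation of the three-point power-sum statistics at fixed mesh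

Crux `Summit.CriticalPhenomena.CardyFormulaZ2.Theses.CardyMagicRigidity.MagicFormulaT`
(stmt-CriticalPhenomena-4836), line `Sketch`, registered sub-goal
`cr3_expect_powerSums_eq_counts`: the order-3 analogue of the landed order-2 bridge
`cr_expect_powerSums_eq_counts`.  With `θ_u = u.nestingPhase f = ∫_{W(u,·) ≠ 0} f` over the
interface loops `u` of `siteLoopConfig δ ω` under `triSitePercolation half`, an admissible density
`f` (measurable, `|f| ≤ C`, `f = 0` off `B̄(0, R)`, `∫ f = 0`) and a mesh `δ > 0`:
`E[Σ_u θ_u³] = ∭ f f f E[N(x ∧ y ∧ z)]`, `E[(Σ_u θ_u)(Σ_u θ_u²)] = ∭ f f f E[N(x) N(y ∧ z)]`,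
`E[(Σ_u θ_u)³] = ∭ f f f E[N(x) N(y) N(z)]`, where `N(x) = #{u : W(u, x) ≠ 0, u meets B̄(0, R)}`
and `N(y ∧ z)`, `N(x ∧ y ∧ z)` are its two- and three-point analogues.

* §1 the PATHWISE identities (`cr3_pathwise`): only the finitely many loops meeting `B̄(0, R)`
  contribute (`sw_meets_of_nestingPhase_ne_zero`), `θ_u = ∫ f 𝟙_{W(u,·) ≠ 0}`, products of
  integrals are iterated integrals, finite sums commute with integrals, and the two inner
  integrals are the order-2 identities `cr_pathwise`;
* §2 Fubini (`cr3_integral_swap`): the order-2 lemma `cr_integral_integral_integral_swap` applied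
  to the partially integrated kernel `∫ f(z) K(·, x, y, z) dz`, then `integral_integral_swap`;
* §3 the registered sub-goal: the counts are bounded by the deterministic number of loops meeting
  the ball (`ncard_loops_siteLoopConfig_meeting_le`) and jointly measurable
  (`cr_measurable_ncard_loops`).

Everything is proved from tree / Mathlib material; no named fact is used; no definition is
introduced.
-/

noncomputable section

namespace Summit.CriticalPhenomena.CardyFormulaZ2.Cruxes.MagicFormulaT.LineSketch

open MeasureTheory Filter Set Metric
open scoped Real Topology BigOperators ENNReal
open Literature.Probability.RandomPlanarGeometry Literature.Probability.Percolation
  Literature.Probability.LatticeModels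

/-! ## §1 The pathwise three-point count representation -/

/-- **Pathwise three-point count representation.**  For an admissible density `f` and a loop
family `L` with finitely many loops meeting `B̄(0, R)`, with
`N(x) = #{u ∈ L : W(u,x) ≠ 0, u meets B̄(0,R)}` and its two- and three-point analogues:
`Σ_u θ_u³ = ∭ f f f N(x ∧ y ∧ z)`, `(Σ_u θ_u)(Σ_u θ_u²) = ∭ f f f N(x) N(y ∧ z)` and
`(Σ_u θ_u)³ = ∭ f f f N(x) N(y) N(z)` — honest finite sums over the loops meeting the ball
(`sw_meets_of_nestingPhase_ne_zero`), `θ_u = ∫ f 𝟙_{W(u,·) ≠ 0}`, finite sums exchanged with the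
integrals, and the order-2 identities `cr_pathwise` for the two inner integrals. -/
theorem cr3_pathwise {f : ℂ → ℝ} {R C : ℝ} (hf : Measurable f) (hC : ∀ z, |f z| ≤ C)
    (hR : ∀ z, R < ‖z‖ → f z = 0) (h0 : ∫ z, f z = 0) {L : Set (UnbasedLoop ℂ)}
    (hT : {u ∈ L | (u.range ∩ closedBall (0 : ℂ) R).Nonempty}.Finite) :
    (∑ᶠ u ∈ L, u.nestingPhase f ^ 3) = ∫ x, ∫ y, ∫ z, f x * f y * f z *
        (Set.ncard {u ∈ L | u.wind x ≠ 0 ∧ u.wind y ≠ 0 ∧ u.wind z ≠ 0 ∧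
          (u.range ∩ closedBall (0 : ℂ) R).Nonempty} : ℝ) ∧
    (∑ᶠ u ∈ L, u.nestingPhase f) * (∑ᶠ u ∈ L, u.nestingPhase f ^ 2) =
      ∫ x, ∫ y, ∫ z, f x * f y * f z *
        ((Set.ncard {u ∈ L | u.wind x ≠ 0 ∧ (u.range ∩ closedBall (0 : ℂ) R).Nonempty} : ℝ) *
          (Set.ncard {u ∈ L | u.wind y ≠ 0 ∧ u.wind z ≠ 0 ∧
            (u.range ∩ closedBall (0 : ℂ) R).Nonempty} : ℝ)) ∧
    (∑ᶠ u ∈ L, u.nestingPhase f) ^ 3 = ∫ x, ∫ y, ∫ z, f x * f y * f z *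
        ((Set.ncard {u ∈ L | u.wind x ≠ 0 ∧ (u.range ∩ closedBall (0 : ℂ) R).Nonempty} : ℝ) *
          (Set.ncard {u ∈ L | u.wind y ≠ 0 ∧ (u.range ∩ closedBall (0 : ℂ) R).Nonempty} : ℝ) *
          (Set.ncard {u ∈ L | u.wind z ≠ 0 ∧
            (u.range ∩ closedBall (0 : ℂ) R).Nonempty} : ℝ)) := by
  classical
  -- the finite family `S` of loops meeting the ball, and the interior indicators `g u`
  obtain ⟨S, hmemS⟩ : ∃ S : Finset (UnbasedLoop ℂ), ∀ u, u ∈ S ↔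
      u ∈ L ∧ (u.range ∩ closedBall (0 : ℂ) R).Nonempty :=
    ⟨hT.toFinset, fun u ↦ by rw [Set.Finite.mem_toFinset, Set.mem_setOf_eq]⟩
  obtain ⟨g, hg⟩ : ∃ g : UnbasedLoop ℂ → ℂ → ℝ, ∀ u, g u = {z | u.wind z ≠ 0}.indicator f :=
    ⟨_, fun _ ↦ rfl⟩
  have hfi : Integrable f volume := integrable_of_abs_le_of_eq_zero hf hC hR
  have hgi : ∀ u, Integrable (g u) volume := fun u ↦ by
    rw [hg]
    exact hfi.indicator (measurableSet_setOf_wind_ne_zero u)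
  have hθ : ∀ u : UnbasedLoop ℂ, u.nestingPhase f = ∫ x, g u x := fun u ↦ by
    rw [hg]
    exact (integral_indicator (measurableSet_setOf_wind_ne_zero u)).symm
  have hg1 : ∀ u x, u.wind x ≠ 0 → g u x = f x := fun u x hx ↦ by
    rw [hg]
    exact Set.indicator_of_mem hx f
  have hg0 : ∀ u x, ¬u.wind x ≠ 0 → g u x = 0 := fun u x hx ↦ by
    rw [hg]
    exact Set.indicator_of_notMem hx f
  -- finsums are finite sums over `S`
  have hfs : ∀ φ : ℝ → ℝ, φ 0 = 0 →
      ∑ᶠ u ∈ L, φ (u.nestingPhase f) = ∑ u ∈ S, φ (u.nestingPhase f) := by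
    intro φ hφ
    refine finsum_mem_eq_sum_of_subset _ (fun u hu ↦ ?_) (fun u hu ↦ ((hmemS u).1 hu).1)
    rw [Finset.mem_coe, hmemS]
    refine ⟨hu.1, sw_meets_of_nestingPhase_ne_zero hR h0 fun h ↦ hu.2 ?_⟩
    show φ (u.nestingPhase f) = 0
    rw [h, hφ]
  -- the one-point and three-point counts as finite sums of indicators
  have hC1 : ∀ x, ∑ u ∈ S, g u x = f x *
      (Set.ncard {u ∈ L | u.wind x ≠ 0 ∧ (u.range ∩ closedBall (0 : ℂ) R).Nonempty} : ℝ) := by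
    intro x
    rw [cr_sum_eq_card_mul S (fun u ↦ u.wind x ≠ 0) (fun u ↦ g u x) (f x)
        (fun u _ hu ↦ hg1 u x hu) (fun u _ hu ↦ hg0 u x hu),
      cr_ncard_sep_eq_card_filter hmemS _ (fun u ↦ u.wind x ≠ 0) (fun u ↦ Iff.rfl), mul_comm]
  have hC3 : ∀ x y z, ∑ u ∈ S, g u x * g u y * g u z = f x * f y * f z *
      (Set.ncard {u ∈ L | u.wind x ≠ 0 ∧ u.wind y ≠ 0 ∧ u.wind z ≠ 0 ∧
        (u.range ∩ closedBall (0 : ℂ) R).Nonempty} : ℝ) := by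
    intro x y z
    have hq : ∀ u : UnbasedLoop ℂ, (u.wind x ≠ 0 ∧ u.wind y ≠ 0 ∧ u.wind z ≠ 0 ∧
        (u.range ∩ closedBall (0 : ℂ) R).Nonempty) ↔
        (u.wind x ≠ 0 ∧ u.wind y ≠ 0 ∧ u.wind z ≠ 0) ∧
          (u.range ∩ closedBall (0 : ℂ) R).Nonempty := fun u ↦ by
      rw [and_assoc, and_assoc]
    have hz : ∀ u ∈ S, ¬(u.wind x ≠ 0 ∧ u.wind y ≠ 0 ∧ u.wind z ≠ 0) →
        g u x * g u y * g u z = 0 := by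
      intro u _ hu
      rcases not_and_or.1 hu with h | h
      · rw [hg0 u x h, zero_mul, zero_mul]
      · rcases not_and_or.1 h with h' | h'
        · rw [hg0 u y h', mul_zero, zero_mul]
        · rw [hg0 u z h', mul_zero]
    rw [cr_sum_eq_card_mul S (fun u ↦ u.wind x ≠ 0 ∧ u.wind y ≠ 0 ∧ u.wind z ≠ 0)
        (fun u ↦ g u x * g u y * g u z) (f x * f y * f z)
        (fun u _ hu ↦ by rw [hg1 u x hu.1, hg1 u y hu.2.1, hg1 u z hu.2.2]) hz,
      cr_ncard_sep_eq_card_filter hmemS _ (fun u ↦ u.wind x ≠ 0 ∧ u.wind y ≠ 0 ∧ u.wind z ≠ 0)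
        hq, mul_comm]
  -- `A₁ = ∫ f N`
  have hA1 : ∑ᶠ u ∈ L, u.nestingPhase f = ∫ x, f x *
      (Set.ncard {u ∈ L | u.wind x ≠ 0 ∧ (u.range ∩ closedBall (0 : ℂ) R).Nonempty} : ℝ) := by
    rw [hfs (fun t ↦ t) rfl]
    calc ∑ u ∈ S, u.nestingPhase f = ∑ u ∈ S, ∫ x, g u x :=
          Finset.sum_congr rfl fun u _ ↦ hθ u
      _ = ∫ x, ∑ u ∈ S, g u x := (integral_finsetSum S fun u _ ↦ hgi u).symm
      _ = _ := integral_congr_ae (Eventually.of_forall fun x ↦ hC1 x)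
  refine ⟨?_, ?_, ?_⟩
  · -- `Σ_u θ_u³`
    rw [hfs (fun t ↦ t ^ 3) (by norm_num)]
    calc ∑ u ∈ S, u.nestingPhase f ^ 3
        = ∑ u ∈ S, ∫ x, g u x * u.nestingPhase f ^ 2 :=
          Finset.sum_congr rfl fun u _ ↦ by rw [integral_mul_const, ← hθ u]; ring
      _ = ∫ x, ∑ u ∈ S, g u x * u.nestingPhase f ^ 2 :=
          (integral_finsetSum S fun u _ ↦ (hgi u).mul_const _).symm
      _ = ∫ x, ∑ u ∈ S, ∫ y, g u x * g u y * u.nestingPhase f :=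
          integral_congr_ae (Eventually.of_forall fun x ↦ Finset.sum_congr rfl fun u _ ↦ by
            rw [integral_mul_const, integral_const_mul, ← hθ u]; ring)
      _ = ∫ x, ∫ y, ∑ u ∈ S, g u x * g u y * u.nestingPhase f :=
          integral_congr_ae (Eventually.of_forall fun x ↦
            (integral_finsetSum S fun u _ ↦ ((hgi u).const_mul _).mul_const _).symm)
      _ = ∫ x, ∫ y, ∑ u ∈ S, ∫ z, g u x * g u y * g u z :=
          integral_congr_ae (Eventually.of_forall fun x ↦ integral_congr_ae
            (Eventually.of_forall fun y ↦ Finset.sum_congr rfl fun u _ ↦ by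
              rw [integral_const_mul, ← hθ u]))
      _ = ∫ x, ∫ y, ∫ z, ∑ u ∈ S, g u x * g u y * g u z :=
          integral_congr_ae (Eventually.of_forall fun x ↦ integral_congr_ae
            (Eventually.of_forall fun y ↦
              (integral_finsetSum S fun u _ ↦ (hgi u).const_mul _).symm))
      _ = _ :=
          integral_congr_ae (Eventually.of_forall fun x ↦ integral_congr_ae
            (Eventually.of_forall fun y ↦ integral_congr_ae
              (Eventually.of_forall fun z ↦ hC3 x y z)))
  · -- `(Σ_u θ_u)(Σ_u θ_u²)`
    rw [(cr_pathwise hf hC hR h0 hT).1, hA1, ← integral_mul_const]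
    refine integral_congr_ae ?_
    filter_upwards with x
    rw [← integral_const_mul]
    refine integral_congr_ae ?_
    filter_upwards with y
    rw [← integral_const_mul]
    refine integral_congr_ae ?_
    filter_upwards with z
    ring
  · -- `(Σ_u θ_u)³`
    rw [pow_succ', (cr_pathwise hf hC hR h0 hT).2, hA1, ← integral_mul_const]
    refine integral_congr_ae ?_
    filter_upwards with x
    rw [← integral_const_mul]
    refine integral_congr_ae ?_
    filter_upwards with y
    rw [← integral_const_mul]
    refine integral_congr_ae ?_
    filter_upwards with z
    ring

/-! ## §2 Fubini: the expectation past the three spatial integrals -/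

/-- **Fubini for a bounded, jointly measurable three-point loop kernel.**  For a finite measure
`P`, an integrable measurable `f` and a jointly measurable kernel `K ω x y z` with `|K| ≤ B`:
`E[∭ f(x) f(y) f(z) K(·, x, y, z)] = ∭ f(x) f(y) f(z) E[K(·, x, y, z)]` (the order-2 lemma
`cr_integral_integral_integral_swap` for the partially integrated kernel `∫ f(z) K(·, x, y, z) dz`,
then `MeasureTheory.integral_integral_swap`, domination by `B |f(z)|`). -/
theorem cr3_integral_swap {Ω : Type*} [MeasurableSpace Ω] (P : Measure Ω)
    [IsFiniteMeasure P] {f : ℂ → ℝ} (hfi : Integrable f volume) (hfm : Measurable f)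
    {K : Ω → ℂ → ℂ → ℂ → ℝ} {B : ℝ} (hKB : ∀ ω x y z, |K ω x y z| ≤ B)
    (hKm : Measurable fun r : ((Ω × ℂ) × ℂ) × ℂ ↦ K r.1.1.1 r.1.1.2 r.1.2 r.2) :
    ∫ ω, (∫ x, ∫ y, ∫ z, f x * f y * f z * K ω x y z) ∂P =
      ∫ x, ∫ y, ∫ z, f x * f y * f z * ∫ ω, K ω x y z ∂P := by
  have hGm : Measurable fun s : ((Ω × ℂ) × ℂ) × ℂ ↦ f s.2 * K s.1.1.1 s.1.1.2 s.1.2 s.2 :=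
    (hfm.comp measurable_snd).mul hKm
  have hpt : ∀ ω x y z, ‖f z * K ω x y z‖ ≤ B * |f z| := fun ω x y z ↦ by
    rw [Real.norm_eq_abs, abs_mul]
    exact (mul_le_mul_of_nonneg_left (hKB ω x y z) (abs_nonneg _)).trans_eq (mul_comm _ _)
  -- the partially integrated kernel `K₂ ω x y = ∫ f(z) K ω x y z dz` is bounded ...
  have hK₂B : ∀ ω x y, |∫ z, f z * K ω x y z| ≤ B * ∫ z, |f z| := fun ω x y ↦ by
    rw [← Real.norm_eq_abs, ← integral_const_mul]
    exact norm_integral_le_of_norm_le (hfi.abs.const_mul B)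
      (Eventually.of_forall fun z ↦ hpt ω x y z)
  -- ... and jointly measurable
  have hK₂sm : StronglyMeasurable fun r : (Ω × ℂ) × ℂ ↦ ∫ z, f z * K r.1.1 r.1.2 r.2 z :=
    hGm.stronglyMeasurable.integral_prod_right'
  -- integrability on `Ω × ℂ` of `(ω, z) ↦ f z K ω x y z` for every `x, y`
  have hI : ∀ x y, Integrable (Function.uncurry fun ω z ↦ f z * K ω x y z) (P.prod volume) := by
    intro x y
    have hm : Measurable fun q : Ω × ℂ ↦ f q.2 * K q.1 x y q.2 :=
      hGm.comp (((measurable_fst.prodMk measurable_const).prodMk measurable_const).prodMk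
        measurable_snd)
    exact Integrable.mono' ((integrable_const B).mul_prod hfi.abs) hm.aestronglyMeasurable
      (Eventually.of_forall fun q ↦ hpt q.1 x y q.2)
  calc ∫ ω, (∫ x, ∫ y, ∫ z, f x * f y * f z * K ω x y z) ∂P
      = ∫ ω, (∫ x, ∫ y, f x * f y * ∫ z, f z * K ω x y z) ∂P :=
        integral_congr_ae (Eventually.of_forall fun ω ↦ integral_congr_ae
          (Eventually.of_forall fun x ↦ integral_congr_ae (Eventually.of_forall fun y ↦
            (integral_congr_ae (Eventually.of_forall fun z ↦ mul_assoc _ _ _)).trans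
              (integral_const_mul _ _))))
    _ = ∫ x, ∫ y, f x * f y * ∫ ω, (∫ z, f z * K ω x y z) ∂P :=
        cr_integral_integral_integral_swap P hfi hfm hK₂B hK₂sm.measurable
    _ = _ := by
        refine integral_congr_ae ?_
        filter_upwards with x
        refine integral_congr_ae ?_
        filter_upwards with y
        rw [integral_integral_swap (hI x y), ← integral_const_mul]
        refine integral_congr_ae ?_
        filter_upwards with z
        rw [integral_const_mul]
        ring

/-! ## §3 The registered sub-goal -/

/-- **Sub-goal `cr3_expect_powerSums_eq_counts` · count representation of the three-point
power-sum statistics at fixed mesh.**  For an admissible density `f` (measurable, `|f| ≤ C`,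
`f = 0` off `B̄(0, R)`, `∫ f = 0`) and a mesh `δ > 0`, with `θ_u = ∫_{W(u,·) ≠ 0} f` over the
interface loops of `siteLoopConfig δ ω` under `triSitePercolation half`,
`N(x) = #{u : W(u,x) ≠ 0, u meets B̄(0,R)}`, `N(y ∧ z) = #{u : W(u,y) ≠ 0, W(u,z) ≠ 0, u meets
B̄(0,R)}` and `N(x ∧ y ∧ z) = #{u : W(u,x) ≠ 0, W(u,y) ≠ 0, W(u,z) ≠ 0, u meets B̄(0,R)}`:
`E[Σ_u θ_u³] = ∭ f f f E[N(x ∧ y ∧ z)]`, `E[(Σ_u θ_u)(Σ_u θ_u²)] = ∭ f f f E[N(x) N(y ∧ z)]` and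
`E[(Σ_u θ_u)³] = ∭ f f f E[N(x) N(y) N(z)]`.  Pathwise (`cr3_pathwise`) only the finitely many
loops meeting `B̄(0, R)` contribute (`ncard_loops_siteLoopConfig_meeting_le`); then Fubini
(`cr3_integral_swap`): the counts are bounded by the deterministic number of loops meeting the
ball and jointly measurable (`cr_measurable_ncard_loops`). -/
theorem cr3_expect_powerSums_eq_counts : ∀ (f : ℂ → ℝ) (R C : ℝ), Measurable f → (∀ z, |f z| ≤ C) →
    (∀ z, R < ‖z‖ → f z = 0) → ∫ z, f z = 0 → ∀ δ : ℝ, 0 < δ →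
    (∫ ω, (∑ᶠ u ∈ (siteLoopConfig δ ω).loops, u.nestingPhase f ^ 3) ∂(triSitePercolation half) =
      ∫ x, ∫ y, ∫ z, f x * f y * f z * ∫ ω, (Set.ncard {u ∈ (siteLoopConfig δ ω).loops | u.wind x ≠ 0 ∧ u.wind y ≠ 0 ∧
        u.wind z ≠ 0 ∧ (u.range ∩ Metric.closedBall (0 : ℂ) R).Nonempty} : ℝ) ∂(triSitePercolation half)) ∧
    (∫ ω, (∑ᶠ u ∈ (siteLoopConfig δ ω).loops, u.nestingPhase f) *
        (∑ᶠ u ∈ (siteLoopConfig δ ω).loops, u.nestingPhase f ^ 2) ∂(triSitePercolation half) =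
      ∫ x, ∫ y, ∫ z, f x * f y * f z * ∫ ω, ((Set.ncard {u ∈ (siteLoopConfig δ ω).loops | u.wind x ≠ 0 ∧
        (u.range ∩ Metric.closedBall (0 : ℂ) R).Nonempty} : ℝ) *
        (Set.ncard {u ∈ (siteLoopConfig δ ω).loops | u.wind y ≠ 0 ∧ u.wind z ≠ 0 ∧
        (u.range ∩ Metric.closedBall (0 : ℂ) R).Nonempty} : ℝ)) ∂(triSitePercolation half)) ∧
    (∫ ω, (∑ᶠ u ∈ (siteLoopConfig δ ω).loops, u.nestingPhase f) ^ 3 ∂(triSitePercolation half) =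
      ∫ x, ∫ y, ∫ z, f x * f y * f z * ∫ ω, ((Set.ncard {u ∈ (siteLoopConfig δ ω).loops | u.wind x ≠ 0 ∧
        (u.range ∩ Metric.closedBall (0 : ℂ) R).Nonempty} : ℝ) *
        (Set.ncard {u ∈ (siteLoopConfig δ ω).loops | u.wind y ≠ 0 ∧
        (u.range ∩ Metric.closedBall (0 : ℂ) R).Nonempty} : ℝ) *
        (Set.ncard {u ∈ (siteLoopConfig δ ω).loops | u.wind z ≠ 0 ∧
        (u.range ∩ Metric.closedBall (0 : ℂ) R).Nonempty} : ℝ)) ∂(triSitePercolation half)) := by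
  intro f R C hf hC hR h0 δ hδ
  have hfi : Integrable f volume := integrable_of_abs_le_of_eq_zero hf hC hR
  -- finiteness and the deterministic bound on the loops meeting the ball
  have hT : ∀ ω : SiteConfig (Site 2),
      {u ∈ (siteLoopConfig δ ω).loops | (u.range ∩ closedBall (0 : ℂ) R).Nonempty}.Finite :=
    fun ω ↦ (ncard_loops_siteLoopConfig_meeting_le hδ R ω).1
  obtain ⟨Nmax, hNmax⟩ : ∃ N : ℕ, ∀ ω : SiteConfig (Site 2),
      {u ∈ (siteLoopConfig δ ω).loops | (u.range ∩ closedBall (0 : ℂ) R).Nonempty}.ncard ≤ N :=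
    ⟨_, fun ω ↦ (ncard_loops_siteLoopConfig_meeting_le hδ R ω).2⟩
  have hN₁le : ∀ (ω : SiteConfig (Site 2)) (x : ℂ),
      ((Set.ncard {u ∈ (siteLoopConfig δ ω).loops | u.wind x ≠ 0 ∧
        (u.range ∩ closedBall (0 : ℂ) R).Nonempty} : ℝ)) ≤ Nmax := fun ω x ↦ by
    rw [Nat.cast_le]
    refine (Set.ncard_le_ncard (fun u hu ↦ ?_) (hT ω)).trans (hNmax ω)
    exact ⟨hu.1, hu.2.2⟩
  have hN₂le : ∀ (ω : SiteConfig (Site 2)) (y z : ℂ),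
      ((Set.ncard {u ∈ (siteLoopConfig δ ω).loops | u.wind y ≠ 0 ∧ u.wind z ≠ 0 ∧
        (u.range ∩ closedBall (0 : ℂ) R).Nonempty} : ℝ)) ≤ Nmax := fun ω y z ↦ by
    rw [Nat.cast_le]
    refine (Set.ncard_le_ncard (fun u hu ↦ ?_) (hT ω)).trans (hNmax ω)
    exact ⟨hu.1, hu.2.2.2⟩
  have hN₃le : ∀ (ω : SiteConfig (Site 2)) (x y z : ℂ),
      |((Set.ncard {u ∈ (siteLoopConfig δ ω).loops | u.wind x ≠ 0 ∧ u.wind y ≠ 0 ∧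
        u.wind z ≠ 0 ∧ (u.range ∩ closedBall (0 : ℂ) R).Nonempty} : ℝ))| ≤ Nmax :=
    fun ω x y z ↦ by
    rw [Nat.abs_cast, Nat.cast_le]
    refine (Set.ncard_le_ncard (fun u hu ↦ ?_) (hT ω)).trans (hNmax ω)
    exact ⟨hu.1, hu.2.2.2.2⟩
  have hN₁₂le : ∀ (ω : SiteConfig (Site 2)) (x y z : ℂ),
      |((Set.ncard {u ∈ (siteLoopConfig δ ω).loops | u.wind x ≠ 0 ∧
        (u.range ∩ closedBall (0 : ℂ) R).Nonempty} : ℝ)) *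
        ((Set.ncard {u ∈ (siteLoopConfig δ ω).loops | u.wind y ≠ 0 ∧ u.wind z ≠ 0 ∧
        (u.range ∩ closedBall (0 : ℂ) R).Nonempty} : ℝ))| ≤ Nmax * Nmax := fun ω x y z ↦ by
    rw [abs_mul, Nat.abs_cast, Nat.abs_cast]
    exact mul_le_mul (hN₁le ω x) (hN₂le ω y z) (Nat.cast_nonneg _) (Nat.cast_nonneg _)
  have hN₁₁₁le : ∀ (ω : SiteConfig (Site 2)) (x y z : ℂ),
      |((Set.ncard {u ∈ (siteLoopConfig δ ω).loops | u.wind x ≠ 0 ∧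
        (u.range ∩ closedBall (0 : ℂ) R).Nonempty} : ℝ)) *
        ((Set.ncard {u ∈ (siteLoopConfig δ ω).loops | u.wind y ≠ 0 ∧
        (u.range ∩ closedBall (0 : ℂ) R).Nonempty} : ℝ)) *
        ((Set.ncard {u ∈ (siteLoopConfig δ ω).loops | u.wind z ≠ 0 ∧
        (u.range ∩ closedBall (0 : ℂ) R).Nonempty} : ℝ))| ≤ Nmax * Nmax * Nmax :=
    fun ω x y z ↦ by
    rw [abs_mul, abs_mul, Nat.abs_cast, Nat.abs_cast, Nat.abs_cast]
    exact mul_le_mul (mul_le_mul (hN₁le ω x) (hN₁le ω y) (Nat.cast_nonneg _) (Nat.cast_nonneg _))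
      (hN₁le ω z) (Nat.cast_nonneg _) (mul_nonneg (Nat.cast_nonneg _) (Nat.cast_nonneg _))
  -- joint measurability of the counts
  have hwm : ∀ u : UnbasedLoop ℂ, Measurable fun z ↦ u.wind z ≠ 0 := fun u ↦
    measurableSet_setOf.1 (measurableSet_setOf_wind_ne_zero u)
  have hcast : Measurable fun n : ℕ ↦ (n : ℝ) := measurable_from_nat
  have hmN₃ : Measurable fun r : ((SiteConfig (Site 2) × ℂ) × ℂ) × ℂ ↦
      ((Set.ncard {u ∈ (siteLoopConfig δ r.1.1.1).loops | u.wind r.1.1.2 ≠ 0 ∧ u.wind r.1.2 ≠ 0 ∧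
        u.wind r.2 ≠ 0 ∧ (u.range ∩ closedBall (0 : ℂ) R).Nonempty} : ℝ)) :=
    hcast.comp (cr_measurable_ncard_loops hδ R measurable_fst.fst.fst
      (Q := fun r u ↦ u.wind r.1.1.2 ≠ 0 ∧ u.wind r.1.2 ≠ 0 ∧ u.wind r.2 ≠ 0 ∧
        (u.range ∩ closedBall (0 : ℂ) R).Nonempty)
      (fun u ↦ ((hwm u).comp measurable_fst.fst.snd).and (((hwm u).comp measurable_fst.snd).and
        (((hwm u).comp measurable_snd).and measurable_const)))
      fun _ _ hu ↦ hu.2.2.2)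
  have hmX : Measurable fun r : ((SiteConfig (Site 2) × ℂ) × ℂ) × ℂ ↦
      ((Set.ncard {u ∈ (siteLoopConfig δ r.1.1.1).loops | u.wind r.1.1.2 ≠ 0 ∧
        (u.range ∩ closedBall (0 : ℂ) R).Nonempty} : ℝ)) :=
    hcast.comp (cr_measurable_ncard_loops hδ R measurable_fst.fst.fst
      (Q := fun r u ↦ u.wind r.1.1.2 ≠ 0 ∧ (u.range ∩ closedBall (0 : ℂ) R).Nonempty)
      (fun u ↦ ((hwm u).comp measurable_fst.fst.snd).and measurable_const)
      fun _ _ hu ↦ hu.2)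
  have hmY : Measurable fun r : ((SiteConfig (Site 2) × ℂ) × ℂ) × ℂ ↦
      ((Set.ncard {u ∈ (siteLoopConfig δ r.1.1.1).loops | u.wind r.1.2 ≠ 0 ∧
        (u.range ∩ closedBall (0 : ℂ) R).Nonempty} : ℝ)) :=
    hcast.comp (cr_measurable_ncard_loops hδ R measurable_fst.fst.fst
      (Q := fun r u ↦ u.wind r.1.2 ≠ 0 ∧ (u.range ∩ closedBall (0 : ℂ) R).Nonempty)
      (fun u ↦ ((hwm u).comp measurable_fst.snd).and measurable_const)
      fun _ _ hu ↦ hu.2)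
  have hmZ : Measurable fun r : ((SiteConfig (Site 2) × ℂ) × ℂ) × ℂ ↦
      ((Set.ncard {u ∈ (siteLoopConfig δ r.1.1.1).loops | u.wind r.2 ≠ 0 ∧
        (u.range ∩ closedBall (0 : ℂ) R).Nonempty} : ℝ)) :=
    hcast.comp (cr_measurable_ncard_loops hδ R measurable_fst.fst.fst
      (Q := fun r u ↦ u.wind r.2 ≠ 0 ∧ (u.range ∩ closedBall (0 : ℂ) R).Nonempty)
      (fun u ↦ ((hwm u).comp measurable_snd).and measurable_const)
      fun _ _ hu ↦ hu.2)
  have hmYZ : Measurable fun r : ((SiteConfig (Site 2) × ℂ) × ℂ) × ℂ ↦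
      ((Set.ncard {u ∈ (siteLoopConfig δ r.1.1.1).loops | u.wind r.1.2 ≠ 0 ∧ u.wind r.2 ≠ 0 ∧
        (u.range ∩ closedBall (0 : ℂ) R).Nonempty} : ℝ)) :=
    hcast.comp (cr_measurable_ncard_loops hδ R measurable_fst.fst.fst
      (Q := fun r u ↦ u.wind r.1.2 ≠ 0 ∧ u.wind r.2 ≠ 0 ∧
        (u.range ∩ closedBall (0 : ℂ) R).Nonempty)
      (fun u ↦ ((hwm u).comp measurable_fst.snd).and (((hwm u).comp measurable_snd).and
        measurable_const))
      fun _ _ hu ↦ hu.2.2)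
  refine ⟨?_, ?_, ?_⟩
  · calc ∫ ω, (∑ᶠ u ∈ (siteLoopConfig δ ω).loops, u.nestingPhase f ^ 3)
          ∂(triSitePercolation half)
        = ∫ ω, (∫ x, ∫ y, ∫ z, f x * f y * f z *
            (Set.ncard {u ∈ (siteLoopConfig δ ω).loops | u.wind x ≠ 0 ∧ u.wind y ≠ 0 ∧
              u.wind z ≠ 0 ∧ (u.range ∩ closedBall (0 : ℂ) R).Nonempty} : ℝ))
            ∂(triSitePercolation half) :=
          integral_congr_ae (Eventually.of_forall fun ω ↦ (cr3_pathwise hf hC hR h0 (hT ω)).1)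
      _ = _ := cr3_integral_swap (triSitePercolation half) hfi hf hN₃le hmN₃
  · calc ∫ ω, (∑ᶠ u ∈ (siteLoopConfig δ ω).loops, u.nestingPhase f) *
          (∑ᶠ u ∈ (siteLoopConfig δ ω).loops, u.nestingPhase f ^ 2) ∂(triSitePercolation half)
        = ∫ ω, (∫ x, ∫ y, ∫ z, f x * f y * f z *
            ((Set.ncard {u ∈ (siteLoopConfig δ ω).loops | u.wind x ≠ 0 ∧
              (u.range ∩ closedBall (0 : ℂ) R).Nonempty} : ℝ) *
            (Set.ncard {u ∈ (siteLoopConfig δ ω).loops | u.wind y ≠ 0 ∧ u.wind z ≠ 0 ∧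
              (u.range ∩ closedBall (0 : ℂ) R).Nonempty} : ℝ))) ∂(triSitePercolation half) :=
          integral_congr_ae (Eventually.of_forall fun ω ↦ (cr3_pathwise hf hC hR h0 (hT ω)).2.1)
      _ = _ := cr3_integral_swap (triSitePercolation half) hfi hf hN₁₂le (hmX.mul hmYZ)
  · calc ∫ ω, (∑ᶠ u ∈ (siteLoopConfig δ ω).loops, u.nestingPhase f) ^ 3
          ∂(triSitePercolation half)
        = ∫ ω, (∫ x, ∫ y, ∫ z, f x * f y * f z *
            ((Set.ncard {u ∈ (siteLoopConfig δ ω).loops | u.wind x ≠ 0 ∧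
              (u.range ∩ closedBall (0 : ℂ) R).Nonempty} : ℝ) *
            (Set.ncard {u ∈ (siteLoopConfig δ ω).loops | u.wind y ≠ 0 ∧
              (u.range ∩ closedBall (0 : ℂ) R).Nonempty} : ℝ) *
            (Set.ncard {u ∈ (siteLoopConfig δ ω).loops | u.wind z ≠ 0 ∧
              (u.range ∩ closedBall (0 : ℂ) R).Nonempty} : ℝ))) ∂(triSitePercolation half) :=
          integral_congr_ae (Eventually.of_forall fun ω ↦ (cr3_pathwise hf hC hR h0 (hT ω)).2.2)
      _ = _ := cr3_integral_swap (triSitePercolation half) hfi hf hN₁₁₁le ((hmX.mul hmY).mul hmZ)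

end Summit.CriticalPhenomena.CardyFormulaZ2.Cruxes.MagicFormulaT.LineSketch

end
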